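import Literature.AlgebraicGeometry.Frobenioids.PadicFrobenioidThm12SchemaClosures
import Literature.AlgebraicGeometry.Frobenioids.PadicFrobenioidFrobeniusCompact
import Literature.AlgebraicGeometry.Frobenioids.PadicFrobenioidRmk122Closures
import HarnessLib

/-!
# Frobenioids II, §1 (Thm. 1.2 (i), Rmk. 1.2.2): instance-form closers at THE bound data (proof-only)

S. Mochizuki, *The geometry of Frobenioids II: poly-Frobenioids*, Kyushu J. Math. **62** (2008) 401–460,
§1, Theorem 1.2 (i) (kurims p. 9) and Remark 1.2.2 (kurims p. 10) [cite: MochizukiFrdII2008, Thm 1.2 (i) p.9]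
[cite: MochizukiFrdII2008, Rmk 1.2.2 p.10].

PROOF-ONLY closer file (abc-iut cell, D-0079 L-F sub-cell [FrdI/II], pack E, seat abc-iut-L1-d9 gen 5;
LF-FRD rows **F-1188** `PadicFrd.Thm12_i_types`, **F-1187** `PadicFrd.Thm12_i_standard`, **F-1182**
`PadicFrd.Datum.FixesUnits`, **F-1184** `PadicFrd.Datum.MapsSplittingTo`). Each of these declarations
(statement files `PadicFrobenioidThm12.lean`, seat abc-iut-L1-t4, and `PadicFrobenioidRmk122.lean`) is a
SCHEMA over a free parameter — the `Prop`-valued vocabulary record `V : Thm12Vocab d` (its "model type" /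
"rationally standard type" slots), resp. an arbitrary morphism of model data `U` — whose universal closure
is kernel-false (`not_forall_thm12_i_types`, `not_forall_thm12_i_standard_iff`, `not_forall_fixesUnits`,
`not_forall_mapsSplittingTo`; seats abc-iut-f-046 and abc-iut-f-047). This file states and proves, with NO new
definition, the instance form of each row AT THE BOUND DATA, with the FACT declaration as conclusion head:

* `Datum.thm12_i_types_holds` — Thm. 1.2 (i), 2nd sentence ("`C` is of isotropic, model, Aut-ample,
  Aut^sub-ample, End-ample, and quasi-Frobenius-trivial type, but not of group-like type") for EVERY `p`-adic
  Frobenioid datum `d` with `Φ`, `B` monoids on `D` (print's standing requirement of Ex. 1.1 (ii),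
  `Datum.IsMonoidData`, BY NAME) and every record `V`, at the record whose "model type" slot IS [FrdI]
  Def. 4.5 (i) `PreFrobenioid.IsOfModelType` for `C = d.frobenioid` — by seat abc-iut-f-047's
  `thm12_i_types_of_isFrobenioid` (model type: abc-iut-w4-d108, abc-iut-w5-d214 `thm12_isOfModelType'`; the six
  other clauses abc-iut-L1-d10); premise-free over a base of FSM-type (`…_of_isOfFSMType`) and
  hypothesis-free at `C^⊢(ℚ_p)` (`thm12_i_types_holds_primQp`);
* `Datum.thm12_i_standard_holds` — Thm. 1.2 (i), 3rd sentence ("If `D` is of FSMFF-type, then `C` is of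
  rationally standard type") at the record whose "rationally standard" slot IS [FrdI] Def. 4.5 (iii)
  `IsOfRationallyStandardType` at THE parameters (`PreFrobenioid.rsParams`, support `PrimarySupp`) — by seat
  abc-iut-L6-t10's `thm12_i_standard_rsParams` (Frobenius-compact input `exists_isFrobeniusCompact_untrBirat`);
  premise-free over a base of FSM-type;
* `Datum.fixesUnits_holds`, `Datum.mapsSplittingTo_holds` — Rmk. 1.2.2, sentence 4 ("one obtains a unique
  automorphism `U` of the data `(Φ, B → Φ^gp)` which is the identity on `O^×(−)` … and `Φ`, but which maps
  `τ` … to `u_D · τ`") read at THE `U`: the unique such automorphism (`Classical.choose` of abc-iut-L1-d8's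
  `rmk122UOfBijective_holds`, reading (R1) = under the constancy hypothesis `HasBijectivePullbacks` made
  explicit by the statement file; WITHOUT it the printed sentence is kernel-false at an explicit absolutely
  primitive datum, abc-iut-f-046's `exists_isAbsolutelyPrimitive_not_rmk122` /
  `hasBijectivePullbacks_iff_rmk122U`, `PadicFrobenioidRmk122Witness.lean` / `…Necessity.lean`) fixes
  `O^×(−)` and maps `τ` to `u_D · τ`; hypothesis-free at `C^⊢(ℚ_p)` with `τ = τ_p`
  (`fixesUnits_holds_primQp`, `mapsSplittingTo_holds_primQp`, from `existsUnique_rmk122U_primQp`).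
Rows F-0725 `Rmk121` and F-1166 `NFLocCat.AutBijective` of the same section need no new declaration
(closers of record: `Datum.rmk121_bindFrobenius_holds` p415370; `NFLocCat.not_autBijective_perm_fin_three`
p406500 / `autBijective_of_comm` p415428).
Honest framing: FACT rows are assumption LABELS on OUR typed statements of the refereed [FrdII]; "holds" =
OUR kernel check of OUR typed instance form; nothing here bears on [IUTchIII] Cor. 3.12; typed ≠ proved
elsewhere. No definition, no restated schema.
-/

namespace Literature.AlgebraicGeometry.Frobenioids

open CategoryTheory Opposite

universe v u

namespace PadicFrd

namespace Datum

variable {D : Type u} [Category.{v} D] {p : ℕ} [Fact p.Prime] (d : Datum D p)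

/-! ### F-1188 `Thm12_i_types` at THE binding of the "model type" slot -/

/-- **F-1188, instance form at THE bound record, every datum with monoid data**: [FrdII] Thm. 1.2 (i), second
sentence — "For arbitrary `Λ`, the Frobenioid `C` is of isotropic, model, Aut-ample, Aut^sub-ample, End-ample,
and quasi-Frobenius-trivial type, but not of group-like type" — HOLDS for `C = d.frobenioid` at every vocabulary
record whose "model type" slot is THE [FrdI] Def. 4.5 (i) declaration `PreFrobenioid.IsOfModelType` (which
presupposes "`C` is a Frobenioid", here `isFrobenioid_of_isMonoidData`, with THE square completion
`hasBiratSquares`), granted print's standing requirement "`Φ`, `B` monoids on `D`" (`IsMonoidData`, Ex. 1.1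
(ii)). [cite: MochizukiFrdII2008, Thm 1.2 (i) p.9] -/
theorem thm12_i_types_holds (h : d.IsMonoidData) (V : Thm12Vocab d) :
    Literature.AlgebraicGeometry.Frobenioids.PadicFrd.Thm12_i_types d
      { V with
        IsOfModelType := PreFrobenioid.IsOfModelType d.structureFunctor (d.isFrobenioid_of_isMonoidData h)
          (d.hasBiratSquares (d.isFrobenioid_of_isMonoidData h)) } :=
  d.thm12_i_types_of_isFrobenioid (d.isFrobenioid_of_isMonoidData h)
    (d.hasBiratSquares (d.isFrobenioid_of_isMonoidData h)) _ fun hm => hm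

/-- **F-1188, instance form, PREMISE-FREE over a base of FSM-type** (e.g. `D = B^temp(Π, Π°)⁰` of Ex. 1.3 (i) or
`D = D₀`; there `Φ`, `B` are automatically monoids on `D`, `isMonoidData_of_isOfFSMType`): Thm. 1.2 (i), second
sentence, at the record whose "model type" slot is `PreFrobenioid.IsOfModelType`.
[cite: MochizukiFrdII2008, Thm 1.2 (i) p.9] -/
theorem thm12_i_types_holds_of_isOfFSMType (hD : IsOfFSMType D) (V : Thm12Vocab d) :
    Literature.AlgebraicGeometry.Frobenioids.PadicFrd.Thm12_i_types d
      { V with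
        IsOfModelType := PreFrobenioid.IsOfModelType d.structureFunctor (d.isFrobenioid_of_isOfFSMType hD)
          (d.hasBiratSquares (d.isFrobenioid_of_isOfFSMType hD)) } :=
  d.thm12_i_types_of_isOfFSMType hD _ fun hm => hm

/-! ### F-1187 `Thm12_i_standard` at THE binding of the "rationally standard type" slot -/

/-- **F-1187, instance form at THE bound record, every datum with monoid data**: [FrdII] Thm. 1.2 (i), third
sentence — "If `D` is of FSMFF-type, then `C` is of rationally standard type" — HOLDS for `C = d.frobenioid` at
every vocabulary record whose "rationally standard type" slot is THE [FrdI] Def. 4.5 (iii) declaration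
`PreFrobenioidData.IsOfRationallyStandardType` of the model data at THE parameters `PreFrobenioid.rsParams`
(birationalization `C^birat`, support `PrimarySupp` of Def. 2.4 (i)(d), unit-trivialization `C^un-tr`), granted
"`Φ`, `B` monoids on `D`" (`IsMonoidData`) — seat abc-iut-L6-t10's `thm12_i_standard_rsParams` (the
Frobenius-compact object of `(C^un-tr)^birat` supplied by `exists_isFrobeniusCompact_untrBirat`).
[cite: MochizukiFrdII2008, Thm 1.2 (i) p.9] -/
theorem thm12_i_standard_holds (h : d.IsMonoidData) (V : Thm12Vocab d) :
    Literature.AlgebraicGeometry.Frobenioids.PadicFrd.Thm12_i_standard d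
      { V with
        IsOfRationallyStandardType :=
          (ModelFrobenioid.data d.Φ d.B d.divB).IsOfRationallyStandardType
            (PreFrobenioid.rsParams (d.isFrobenioid_of_isMonoidData h) fun a 𝔭 => PrimarySupp a 𝔭) } :=
  d.thm12_i_standard_rsParams h _ fun hr => hr

/-- **F-1187, instance form, PREMISE-FREE over a base of FSM-type** (`isMonoidData_of_isOfFSMType`; FSM-type
implies FSMFF-type, so the printed premise is then also met): Thm. 1.2 (i), third sentence, at the record whose
"rationally standard type" slot is Def. 4.5 (iii) at THE parameters. [cite: MochizukiFrdII2008, Thm 1.2 (i) p.9] -/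
theorem thm12_i_standard_holds_of_isOfFSMType (hD : IsOfFSMType D) (V : Thm12Vocab d) :
    Literature.AlgebraicGeometry.Frobenioids.PadicFrd.Thm12_i_standard d
      { V with
        IsOfRationallyStandardType :=
          (ModelFrobenioid.data d.Φ d.B d.divB).IsOfRationallyStandardType
            (PreFrobenioid.rsParams (d.isFrobenioid_of_isMonoidData (d.isMonoidData_of_isOfFSMType hD))
              fun a 𝔭 => PrimarySupp a 𝔭) } :=
  d.thm12_i_standard_rsParams_of_isOfFSMType hD _ fun hr => hr

/-! ### F-1182 `FixesUnits`, F-1184 `MapsSplittingTo` at THE automorphism `U` of Remark 1.2.2 -/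

/-- **F-1182, instance form at THE `U` of Remark 1.2.2** (sentence 4, reading (R1) of the statement file: every
pull-back map of `Φ` bijective, `Φ` absolutely primitive, `Λ = ℤ`): for every section `u_D` of `O^×(−)` and every
characteristic splitting `τ`, THE unique automorphism `U` of the data `(Φ, B → Φ^gp)` of loc. cit. — the witness
of abc-iut-L1-d8's `rmk122UOfBijective_holds` — "is the identity on `O^×(−)`": `FixesUnits U`.
[cite: MochizukiFrdII2008, Rmk 1.2.2 p.10] -/
theorem fixesUnits_holds (hbij : d.HasBijectivePullbacks) (hap : d.IsAbsolutelyPrimitive) (s : d.UnitSection)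
    (T : PreFrobenioid.CharacteristicSplitting d.structureFunctor) :
    Literature.AlgebraicGeometry.Frobenioids.PadicFrd.Datum.FixesUnits d
      (Classical.choose (d.rmk122UOfBijective_holds hbij hap s T)) :=
  (Classical.choose_spec (d.rmk122UOfBijective_holds hbij hap s T)).1.2.1

/-- **F-1184, instance form at THE `U` of Remark 1.2.2** (sentence 4, reading (R1)): THE unique automorphism `U`
of the data "maps `τ` to `u_D · τ`": `MapsSplittingTo U u_D τ`. [cite: MochizukiFrdII2008, Rmk 1.2.2 p.10] -/
theorem mapsSplittingTo_holds (hbij : d.HasBijectivePullbacks) (hap : d.IsAbsolutelyPrimitive)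
    (s : d.UnitSection) (T : PreFrobenioid.CharacteristicSplitting d.structureFunctor) :
    Literature.AlgebraicGeometry.Frobenioids.PadicFrd.Datum.MapsSplittingTo d
      (Classical.choose (d.rmk122UOfBijective_holds hbij hap s T)) s T.τ :=
  (Classical.choose_spec (d.rmk122UOfBijective_holds hbij hap s T)).1.2.2

/-- THE `U` of Remark 1.2.2 is an automorphism of the data which is the identity on `Φ` (the remaining clause of
sentence 4, for completeness of the instance). [cite: MochizukiFrdII2008, Rmk 1.2.2 p.10] -/
theorem isDataAutomorphism_rmk122U (hbij : d.HasBijectivePullbacks) (hap : d.IsAbsolutelyPrimitive)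
    (s : d.UnitSection) (T : PreFrobenioid.CharacteristicSplitting d.structureFunctor) :
    d.IsDataAutomorphism (Classical.choose (d.rmk122UOfBijective_holds hbij hap s T)) :=
  (Classical.choose_spec (d.rmk122UOfBijective_holds hbij hap s T)).1.1

end Datum

/-! ### The same rows at `C^⊢(ℚ_p)`, hypothesis-free -/

section Qp

variable (p : ℕ) [Fact p.Prime]

/-- **F-1188 at `C^⊢(ℚ_p)`, hypothesis-free**: Thm. 1.2 (i), second sentence, for the absolutely primitive
`p`-adic Frobenioid of `ℚ_p` (one-object base of FSM-type, `isOfFSMType_discretePUnit`) at the record whose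
"model type" slot is `PreFrobenioid.IsOfModelType`. [cite: MochizukiFrdII2008, Thm 1.2 (i) p.9] -/
theorem thm12_i_types_holds_primQp (V : Thm12Vocab (Datum.primQp p)) :
    Literature.AlgebraicGeometry.Frobenioids.PadicFrd.Thm12_i_types (Datum.primQp p)
      { V with
        IsOfModelType := PreFrobenioid.IsOfModelType (Datum.primQp p).structureFunctor
          ((Datum.primQp p).isFrobenioid_of_isOfFSMType isOfFSMType_discretePUnit)
          ((Datum.primQp p).hasBiratSquares
            ((Datum.primQp p).isFrobenioid_of_isOfFSMType isOfFSMType_discretePUnit)) } :=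
  (Datum.primQp p).thm12_i_types_holds_of_isOfFSMType isOfFSMType_discretePUnit V

/-- **F-1187 at `C^⊢(ℚ_p)`, hypothesis-free**: Thm. 1.2 (i), third sentence, at the record whose "rationally
standard type" slot is Def. 4.5 (iii) at THE parameters. [cite: MochizukiFrdII2008, Thm 1.2 (i) p.9] -/
theorem thm12_i_standard_holds_primQp (V : Thm12Vocab (Datum.primQp p)) :
    Literature.AlgebraicGeometry.Frobenioids.PadicFrd.Thm12_i_standard (Datum.primQp p)
      { V with
        IsOfRationallyStandardType :=
          (ModelFrobenioid.data (Datum.primQp p).Φ (Datum.primQp p).B (Datum.primQp p).divB).IsOfRationallyStandardType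
            (PreFrobenioid.rsParams
              ((Datum.primQp p).isFrobenioid_of_isMonoidData
                ((Datum.primQp p).isMonoidData_of_isOfFSMType isOfFSMType_discretePUnit))
              fun a 𝔭 => PrimarySupp a 𝔭) } :=
  (Datum.primQp p).thm12_i_standard_holds_of_isOfFSMType isOfFSMType_discretePUnit V

/-- **F-1182 at `C^⊢(ℚ_p)`, hypothesis-free** (`Φ = ord(ℤ_p^⊳)` IS absolutely primitive with bijective
pull-backs; `τ = τ_p`): THE unique automorphism `U` of Remark 1.2.2 (`existsUnique_rmk122U_primQp`) fixes
`O^×(−)`. [cite: MochizukiFrdII2008, Rmk 1.2.2 p.10] -/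
theorem fixesUnits_holds_primQp (s : (Datum.primQp p).UnitSection) :
    Literature.AlgebraicGeometry.Frobenioids.PadicFrd.Datum.FixesUnits (Datum.primQp p)
      (Classical.choose (existsUnique_rmk122U_primQp p s)) :=
  (Classical.choose_spec (existsUnique_rmk122U_primQp p s)).1.2.1

/-- **F-1184 at `C^⊢(ℚ_p)`, hypothesis-free**: THE unique automorphism `U` of Remark 1.2.2 maps `τ_p` to
`u_D · τ_p`. [cite: MochizukiFrdII2008, Rmk 1.2.2 p.10] -/
theorem mapsSplittingTo_holds_primQp (s : (Datum.primQp p).UnitSection) :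
    Literature.AlgebraicGeometry.Frobenioids.PadicFrd.Datum.MapsSplittingTo (Datum.primQp p)
      (Classical.choose (existsUnique_rmk122U_primQp p s)) s (τQp p).τ :=
  (Classical.choose_spec (existsUnique_rmk122U_primQp p s)).1.2.2

end Qp

end PadicFrd

end Literature.AlgebraicGeometry.Frobenioids
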